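import Mathlib
import HarnessLib
import Literature.AlgebraicGeometry.Crystalline.BlochEsnaultKerzLifting
import Literature.AlgebraicGeometry.Deformation.VectorBundleLifting
import Literature.AlgebraicGeometry.Motives.HodgeSheaves

/-!
# Sketch — crux-ideate `stmt-HodgeConjecture-13815` (PadicPridhamSemiregularity), ideator 3, round 1

First lemmas of this seat's idea cards (A = `cartan-classifying-map`, C = `dgm-syntomic-receptacle`;
B was not filed, its lemma is kept), stated over EXISTING tree declarations only
(`CrystallineRealization` with its integral lattice `Hcris`/`ι`, Berthelot–Ogus map `bo` and
rational Hodge filtration `dR.fil`; `WittScheme.thickening`/`specialFibreToThickening`/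
`thickeningMap`; `hodgeCohomology`; `KTheory.KZero`). Level-wise ("mod pᵐ") Hodge conditions are
expressed in VALUATION FORM through the integral lattice pieces
`Λ_j := bo(ι(H²ʳ_cris(X_k/W))) ∩ Fʲ H²ʳ_dR(X_K/K)`, which under torsion-free Hodge cohomology are
the Hodge-filtration lattices of `H²ʳ_dR(𝒳/W)` and reduce onto `Fʲ H²ʳ_dR(X_m/W_m)` at every level.
Nothing here is proved; everything elaborates.
-/

noncomputable section

open CategoryTheory AlgebraicGeometry Opposite
open Literature.AlgebraicGeometry.Motives Literature.AlgebraicGeometry.Motives.WittScheme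
open Literature.AlgebraicGeometry.Crystalline Literature.AlgebraicGeometry.KTheory
open scoped Isocrystal

namespace Summit.HodgeConjecture.HodgeConjecture.Cruxes.PadicPridhamSemiregularity.IdeatorThree

universe u

variable {p : ℕ} [Fact p.Prime] {k : Type u} [Field k] [CharP k p] [PerfectRing k p]

/-- The integral Hodge lattice piece `Λ_j ⊆ H²ʳ_dR(X_K/K)`:
`Λ_j := bo(ι(H²ʳ_cris(X_k/W))) ∩ Fʲ H²ʳ_dR(X_K/K)` (a `W`-stable subgroup). -/
def hodgeLattice (C : CrystallineRealization p k) (𝒳 : SchemeOver (WittVector p k)) (r : ℕ)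
    (j : ℤ) : AddSubgroup (C.dR.obj (genericFibre 𝒳) (2 * r)) :=
  ((C.bo 𝒳 (2 * r)).toAddMonoidHom.comp (C.ι (specialFibre 𝒳) (2 * r)).toAddMonoidHom).range ⊓
    (C.dR.fil (X := genericFibre 𝒳) (2 * r) j).toAddSubgroup

/-- `H•_cris(X/W)` is torsion-free: the rationalisation map `ι` is injective in every degree. -/
def CrisTorsionFree (C : CrystallineRealization p k) (X : SchemeOver k) : Prop :=
  ∀ (i : ℕ) (x : (C.Hcris i).obj (op X)), C.ι X i x = 0 → x = 0

/-- Hodge cohomology `Hᵇ(𝒳, Ωᵃ_{𝒳/W})` has no `p`-torsion for all `a, b` (Bloch–Esnault–Kerz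
Rem. 35 (2); the route's standing hypothesis, now typable through `Motives.hodgeCohomology`). -/
def HodgeTorsionFree (𝒳 : SchemeOver (WittVector p k)) : Prop :=
  ∀ (a b : ℕ) (x : hodgeCohomology 𝒳 a b), (p : ℤ) • x = 0 → x = 0

/-- `x ∈ H²ʳ_cris(X_k/W)` is an integral lift of `r! · chᵣ^cris(E)` (classically such an `x`
exists for `r < p`: integral crystalline Chern classes; `C.chCris` is only the rational class). -/
def IsIntegralChern (C : CrystallineRealization p k) (X : SchemeOver k) (E : X.left.Modules)
    (r : ℕ) (x : (C.Hcris (2 * r)).obj (op X)) : Prop :=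
  C.ι X (2 * r) x = ((r.factorial : ℕ) : K(p, k)) • C.chCris X E r

/-- `x ∈ H²ʳ_cris` is **Hodge up to level `m`**: `bo(ι x) ∈ Λ_r + pᵐ Λ_0`, i.e. (torsion-free case)
`x mod pᵐ ∈ Fʳ H²ʳ_dR(X_m/W_m)`. -/
def HodgeUpToLevel (C : CrystallineRealization p k) (𝒳 : SchemeOver (WittVector p k)) (r m : ℕ)
    (x : (C.Hcris (2 * r)).obj (op (specialFibre 𝒳))) : Prop :=
  ∃ a ∈ hodgeLattice C 𝒳 r r, ∃ b ∈ hodgeLattice C 𝒳 r 0,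
    C.bo 𝒳 (2 * r) (C.ι (specialFibre 𝒳) (2 * r) x) = a + ((p : K(p, k)) ^ m) • b

/-! ### Card A (`cartan-classifying-map`) — first lemma: p-adic Griffiths transversality one level down

If a finite locally free `F` exists on `X_{n+1}` then the level-`(n+2)` Hodge defect of
`r!·chᵣ^cris(F|_{X_k})` lies in the LAST COLUMN `H^{r+1}(X_k, Ω^{r-1}) ⊗ pⁿ⁺¹W/pⁿ⁺²`, i.e.
`x mod pⁿ⁺² ∈ Fʳ + pⁿ⁺¹ F^{r-1}`: the refuters' "unbacked p-adic transversality claim" (CRUX-ATTACK-g2,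
D1/D2), which the Cartan-homotopy computation gives for free (contraction `ι_θ` lowers the Hodge
degree by exactly one; Taylor terms of order `≥ 2` in `pⁿ⁺¹θ` vanish mod `pⁿ⁺²` for `p` odd). -/

/-- **First lemma of card A.** For `𝒳/W(k)` a smooth projective model of relative dimension
`d < p`, `p ≠ 2`, with torsion-free crystalline and Hodge cohomology, every finite locally free
`F` on the thickening `X_{n+1} = 𝒳 ⊗ W/pⁿ⁺¹` and every integral lift `x` of `r!·chᵣ^cris(F|_{X_k})`,
`1 ≤ r < p`: `bo(ι x) ∈ Λ_r + pⁿ⁺¹ Λ_{r-1} + pⁿ⁺² Λ_0`. -/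
def TransversalityOneLevelDown (C : CrystallineRealization p k) : Prop :=
  ∀ ⦃d : ℕ⦄ ⦃𝒳 : SchemeOver (WittVector p k)⦄, IsSmoothProperModel d 𝒳 → IsProjectiveOverRing 𝒳 →
    d < p → p ≠ 2 → CrisTorsionFree C (specialFibre 𝒳) → HodgeTorsionFree 𝒳 →
    ∀ (n r : ℕ) (F : (thickening 𝒳 (n + 1)).left.Modules), IsFiniteLocallyFree F → 1 ≤ r → r < p →
      ∀ x : (C.Hcris (2 * r)).obj (op (specialFibre 𝒳)),
        IsIntegralChern C (specialFibre 𝒳)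
          ((Scheme.Modules.pullback (specialFibreToThickening 𝒳 n)).obj F) r x →
        ∃ a ∈ hodgeLattice C 𝒳 r r, ∃ c ∈ hodgeLattice C 𝒳 r ((r : ℤ) - 1),
          ∃ b ∈ hodgeLattice C 𝒳 r 0,
            C.bo 𝒳 (2 * r) (C.ι (specialFibre 𝒳) (2 * r) x) =
              a + ((p : K(p, k)) ^ (n + 1)) • c + ((p : K(p, k)) ^ (n + 2)) • b

/-! ### (Unfiled card B, kept for the sibling intrinsic cards `absolute-atiyah-window-collapse` /
`crystalline-abel-jacobi` and as the `→` direction of card C) — the divided-power Hodge condition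

A bundle on `X_{n+1}` has Chern classes in the PD-Hodge filtration `Fʳ_J`, `J = (pⁿ⁺¹)`, of
`H_cris(X_{n+1}/W)` = the Hodge filtration of derived de Rham cohomology `LΩ_{X_{n+1}/W}`; on the
lift this is `Σ_j J^{[j]} F^{r-j}` with `J^{[j]} = p^{(n+1)j}/j!`. For `n = 0` this is
Bloch–Esnault–Kerz's `p(r)Ω`; mod `pⁿ⁺²` only `j ≤ 1` survives (card A's lemma); the deeper
divided powers are the refuters' "window" for the pro-system. -/

/-- **Divided-power Hodge condition (all deeper levels).** Same hypotheses; conclusion: for every `N`,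
`bo(ι x) ∈ Σ_{j=0}^{r} p^{(n+1)j - v_p(j!)} Λ_{r-j} + p^N Λ_0`. -/
def DividedPowerHodgeCondition (C : CrystallineRealization p k) : Prop :=
  ∀ ⦃d : ℕ⦄ ⦃𝒳 : SchemeOver (WittVector p k)⦄, IsSmoothProperModel d 𝒳 → IsProjectiveOverRing 𝒳 →
    d < p → p ≠ 2 → CrisTorsionFree C (specialFibre 𝒳) → HodgeTorsionFree 𝒳 →
    ∀ (n r : ℕ) (F : (thickening 𝒳 (n + 1)).left.Modules), IsFiniteLocallyFree F → r < p →
      ∀ x : (C.Hcris (2 * r)).obj (op (specialFibre 𝒳)),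
        IsIntegralChern C (specialFibre 𝒳)
          ((Scheme.Modules.pullback (specialFibreToThickening 𝒳 n)).obj F) r x →
        ∀ N : ℕ, ∃ (a : Fin (r + 1) → C.dR.obj (genericFibre 𝒳) (2 * r))
          (b : C.dR.obj (genericFibre 𝒳) (2 * r)),
          (∀ j : Fin (r + 1), a j ∈ hodgeLattice C 𝒳 r ((r : ℤ) - (j : ℕ))) ∧
          b ∈ hodgeLattice C 𝒳 r 0 ∧
          C.bo 𝒳 (2 * r) (C.ι (specialFibre 𝒳) (2 * r) x) =
            (∑ j : Fin (r + 1),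
              ((p : K(p, k)) ^ ((n + 1) * (j : ℕ) - ((j : ℕ).factorial).factorization p)) • a j) +
              ((p : K(p, k)) ^ N) • b

/-! ### Card C (`dgm-syntomic-receptacle`) — first lemma: level-wise class lifting is decided by the
DIVIDED-POWER Hodge condition of the next level (Dundas–Goodwillie–McCarthy + BMS2/AMMN computation
of `K_{-1}(X_{n+2}, X_{n+1})`)

`K₀(X_{n+2}) → K₀(X_{n+1}) →∂ K_{-1}(X_{n+2},X_{n+1}) ≅ TC_{-1}^{rel}`, filtered with graded pieces
`H²ⁱ(𝒳̂, 𝒲_i)`, `𝒲_i = Fⁱ_{J_{n+1}}/Fⁱ_{J_{n+2}} = [𝒪/pⁱ → Ω¹/p^{i-1} → … → Ω^{i-1}/p]`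
(`i ≤ p − 2`): the obstruction `∂[F]` vanishes iff the filtered crystalline Chern classes of `F`
satisfy the divided-power condition of `J_{n+2} = (p^{n+2})`, not merely "Hodge at level `n+2`"
(the deep window `j ≥ 2` is extra). `←` below is the content; `→` is the divided-power lemma of
card B at level `n + 2`. -/

/-- `x ∈ H²ʳ_cris` satisfies the **divided-power Hodge condition of `J_m = (pᵐ)`**:
`bo(ι x) ∈ Σ_{j=0}^{r} p^{m j - v_p(j!)} Λ_{r-j}` (the `j = 0` term is `Λ_r`, the `j = 1` term
`pᵐ Λ_{r-1}`, the `j = r` term `p^{m r - v_p(r!)} Λ_0`). -/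
def DividedPowerHodgeAt (C : CrystallineRealization p k) (𝒳 : SchemeOver (WittVector p k))
    (r m : ℕ) (x : (C.Hcris (2 * r)).obj (op (specialFibre 𝒳))) : Prop :=
  ∃ a : Fin (r + 1) → C.dR.obj (genericFibre 𝒳) (2 * r),
    (∀ j : Fin (r + 1), a j ∈ hodgeLattice C 𝒳 r ((r : ℤ) - (j : ℕ))) ∧
    C.bo 𝒳 (2 * r) (C.ι (specialFibre 𝒳) (2 * r) x) =
      ∑ j : Fin (r + 1), ((p : K(p, k)) ^ (m * (j : ℕ) - ((j : ℕ).factorial).factorization p)) • a j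

/-- **First lemma of card C.** Same hypotheses with `d + 6 < p`: the `K₀`-class of a finite locally
free `F` on `X_{n+1}` lifts to `K₀(X_{n+2})` iff every integral lift of `r!·chᵣ^cris(F|_{X_k})`,
`1 ≤ r ≤ d`, satisfies the divided-power Hodge condition of `(p^{n+2})`. -/
def LevelwiseClassLifting (C : CrystallineRealization p k) : Prop :=
  ∀ ⦃d : ℕ⦄ ⦃𝒳 : SchemeOver (WittVector p k)⦄, IsSmoothProperModel d 𝒳 → IsProjectiveOverRing 𝒳 →
    d + 6 < p → CrisTorsionFree C (specialFibre 𝒳) → HodgeTorsionFree 𝒳 →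
    ∀ (n : ℕ) (F : (thickening 𝒳 (n + 1)).left.Modules) (hF : IsFiniteLocallyFree F),
      (∀ r : ℕ, 1 ≤ r → r ≤ d → ∀ x : (C.Hcris (2 * r)).obj (op (specialFibre 𝒳)),
          IsIntegralChern C (specialFibre 𝒳)
            ((Scheme.Modules.pullback (specialFibreToThickening 𝒳 n)).obj F) r x →
          DividedPowerHodgeAt C 𝒳 r (n + 2) x) ↔
      ∃ y : KZero (thickening 𝒳 (n + 2)).left,
        KZero.map (thickeningMap 𝒳 (Nat.le_succ (n + 1))) y = KZero.of F hF

end Summit.HodgeConjecture.HodgeConjecture.Cruxes.PadicPridhamSemiregularity.IdeatorThree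

end
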